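import Mathlib

/-!
# P8HCofB0FiniteFacts — the FINITE COMBINATORIAL FACTS behind p1 (g11)'s Theorem F (HC(B₀), STATUS l.8134), kernel-checked

p8 (g20), 2026-08-29. Supporting artefact (R-5): finite combinatorics only, never frozen, nothing declared uses it.
Every theorem below is either a `decide +kernel` evaluation of a Boolean program on natural-number codes or an
elementary arithmetic lemma; the encodings are stated in the docstrings.  NOTHING here is an algebraicity statement:
the objects are subsets of `(ℤ/32)^×` and `(ℤ/96)^×`, exponent tuples mod 8 / mod 32 and integer counts.

## The four groups of facts

(A) THE HODGE-RING CENSUS OF B₀ (the page P1-HypergeometricJacobians Theorem C / p1 l.8134 (2)(vii)).  B₀ has CM by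
`L = ℚ(ζ₃₂)`, type `Φ = {1,3,5,7,9,15,19,21} ⊂ U := (ℤ/32)^×` (the class representative).  A subset `S ⊆ U` of even
size `2p` is BALANCED if `|t·S ∩ Φ| = p` for every unit `t` (the line `L_S` is then a Hodge class of codimension `p`
on every Galois conjugate, i.e. a rational Hodge class of `B₀` lives in `⊕_t L_{tS}`).  `Δ := {1, 9, 17, 25}` is the
subgroup `⟨9⟩ ⊂ U` = the `ℚ(ζ₈)`-fibre over `1 mod 8`; its four cosets `Δ, 3Δ, 5Δ, 7Δ` partition `U`, and `−Δ = 7Δ`.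
THEOREM `b0_census`: every balanced subset of `U` (all 65536 subsets are examined; the balanced ones number 324) is a
DISJOINT UNION of conjugate pairs `{s, −s}` and cosets of `⟨9⟩`.  Consequently the Hodge ring of `B₀` is generated by the
divisor classes (the pairs) and the one exceptional orbit `M_O = ⊕_t L_{tΔ}` (the `ℚ(ζ₈)`-Weil classes): B₀'s Hodge
classes are polynomials in divisors and `ℚ(ζ₈)`-Weil classes, so HC(B₀) ⟺ `W_{ℚ(ζ₈)}(B₀)` algebraic (S3 Theorem C).
ENCODING: the 16 units are `unit i = 2i + 1` (`i < 16`); a subset is the 16-bit mask `Σ 2^i`; the conjugate of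
`unit i` is `unit (15 − i)`; the coset of `⟨9⟩` through `unit i` is `{unit j : j ≡ i mod 4}` (mask `4369 <<< (i % 4)`,
`4369 = 0x1111`).  `balancedB m` tests the balance at all 16 translations (through the literal table `phiMasks` of the masks of `t·Φ`,
certified by `phiMasks_spec`, and the parallel bit count `popcount`, certified against the naive count on all 65536
values by `popcount_spec`); `decomp fuel m` removes, from the least element
of `m`, either its conjugate pair or its coset when that set is contained in `m`, and succeeds iff `m` is exhausted.
The 65536 masks are checked in 16 blocks of 4096 (`block_k`, each also returning the number of balanced masks in
its block — 324 in all, `balanced_total`), assembled by `scan_spec`.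

(B) THE ℚ(ζ₈)-WEIL STRUCTURE OF A′ (Theorem E (1)(e)).  `T′ ⊂ (ℤ/96)^×` is the CM type of the sixteenfold A′; each
fibre `F_φ = {k ∈ (ℤ/96)^× : k ≡ φ mod 8}` (`φ ∈ {1,3,5,7}`) has 8 elements and meets `T′` in exactly 4 — A′ is of
Weil type over `ℚ(ζ₈)` with `h = 8` and signature (4,4) at every embedding (`Tp_fibres`); `T′` is a CM type
(`Tp_cm_type`); `F_φ ⊔ F_φ′` is closed under `k ↦ −k` iff `φ′ ≡ −φ mod 8` (`fibre_union_neg`, the set fact of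
(2)(v): the only pairing in the push-forward is `φ ↔ φ̄`).

(C) THE EXPONENT TUPLE OF C₃ (Theorem E (1)(d)–(e)).  For a 4-point totally ramified ℤ/32-cover of ℙ¹ with unit
exponents `α`, Schoen's Lemma 1.6b (row S88-3) gives the multiplicity `ν_n(α) = −1 + Σ_i ⟨n α_i⟩_{32}/32` of the
eigenvalue `ζ₃₂^n` on `H^{1,0}`.  `tuple_multiplicities`: for `α = (7, 21, 1, 3)` these are exactly the lift counts
`#{k ∈ T′ : k ≡ n mod 32}` for all 16 units `n`; `tuple_unique`: `(1, 3, 7, 21)` is the ONLY multiset of four units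
mod 32 with sum `≡ 0` and this multiplicity pattern (the opposite orientation `n ↦ −n` gives `(11, 25, 29, 31)`, the
same tuple mod 8 up to the global sign); `tuple_simple_mod8`: `(7, 21, 1, 3) mod 8 = (7, 5, 1, 3)` is SIMPLE (Schoen
p. 11: after a permutation `ᾱ_{2i} = −ᾱ_{2i−1}`) and balanced.

(D) SIMPLICITY IS AUTOMATIC FROM BALANCE for the two moduli used (a lemma, not a table).  In count form — a `2r`-tuple
in `(ℤ/m − {0})^{2r}` is SIMPLE iff `count a = count (−a)` for every residue `a` (and `count (m/2)` even):
`simple8_of_balanced8`: for `m = 8`, every tuple with entries in `{1, 3, 4, 5, 7}` (units and `4` — the only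
residues occurring for a ℤ/8-quotient of a curve whose points have `μ₈`-stabilisers of order 8 or 2) that is balanced
(`Σ_i ⟨n ᾱ_i⟩₈ = 4·(2r)` for `n ∈ {1,3,5,7}`, Corollary 1.9 row S88-4) is simple; `simple4_of_balanced4`: for
`m = 4` every balanced tuple is simple (Aoki's theorem for `m = 4`, row S88-5, re-proved here by arithmetic).
Hence the hypotheses of Schoen's Theorem 2.0 / Corollary 3.1 for `(C′, μ₈)` (tuple `(3,3,4,4,4,4,5,5)`, Theorem D (ii))
and `(C₃, μ₈)` (tuple `(7,5,1,3)`, Theorem E) follow from the Weil-type Hodge numbers alone (`Cprime_simple`,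
`C3_simple`), independently of any orientation convention for the local exponents.
-/

namespace HodgeRepro0.P8HCofB0FiniteFacts

/-! ### (A) the Hodge-ring census of B₀ -/

/-- The `i`-th unit of `ℤ/32`: `2i + 1`. -/
def unit (i : ℕ) : ℕ := 2 * i + 1

/-- The index of a unit `u` (odd, `< 32`): `(u − 1)/2`. -/
def idx (u : ℕ) : ℕ := (u - 1) / 2

/-- The mask of `B₀`'s type `Φ = {1,3,5,7,9,15,19,21}`: indices 0,1,2,3,4,7,9,10 (= 1695). -/
def phiMask : ℕ := 2^0 + 2^1 + 2^2 + 2^3 + 2^4 + 2^7 + 2^9 + 2^10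

/-- The index list `[0, …, 15]` as a literal (no `List.range` evaluation inside the loops). -/
def idxs : List ℕ := [0, 1, 2, 3, 4, 5, 6, 7, 8, 9, 10, 11, 12, 13, 14, 15]

/-- `idxs` is `List.range 16`. -/
theorem idxs_eq : idxs = List.range 16 := by decide

/-- Number of set bits of `m` (naive: the 16 low bits). -/
def popcountSlow (m : ℕ) : ℕ := idxs.foldl (fun acc i => acc + ((m >>> i) &&& 1)) 0

/-- Number of set bits of `m < 65536` (the parallel bit count; `popcount_spec` checks it against `popcountSlow` on all
65536 values). -/
def popcount (m : ℕ) : ℕ :=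
  let x := m - ((m >>> 1) &&& 21845)
  let y := (x &&& 13107) + ((x >>> 2) &&& 13107)
  let z := (y + (y >>> 4)) &&& 3855
  (z + (z >>> 8)) &&& 255

/-- `popcount = popcountSlow` on `0, …, n − 1`. -/
def popcountCheck : ℕ → Bool
  | 0 => true
  | n + 1 => (popcount n == popcountSlow n) && popcountCheck n

/-- `popcountCheck n = true` means `popcount = popcountSlow` on `0, …, n − 1`. -/
theorem popcountCheck_spec : ∀ n, popcountCheck n = true → ∀ j, j < n → popcount j = popcountSlow j := by
  intro n
  induction n with
  | zero => intro _ j hj; exact absurd hj (Nat.not_lt_zero j)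
  | succ n ih =>
    intro h j hj
    simp only [popcountCheck, Bool.and_eq_true, beq_iff_eq] at h
    rcases Nat.lt_succ_iff_lt_or_eq.mp hj with hlt | heq
    · exact ih h.2 j hlt
    · subst heq; exact h.1

/-- The parallel bit count agrees with the naive one on every `m < 65536` (kernel-checked). -/
theorem popcount_spec : ∀ j, j < 65536 → popcount j = popcountSlow j :=
  popcountCheck_spec 65536 (by decide +kernel)

/-- The mask of `t·S` for the subset `S` coded by `m` (`t` a unit). -/
def mulMask (t m : ℕ) : ℕ :=
  idxs.foldl (fun acc i => if (m >>> i) &&& 1 == 1 then acc + 2 ^ idx (t * unit i % 32) else acc) 0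

/-- The masks of the 16 translates `t·Φ`, `t = unit j`, as a literal table (`phiMasks_spec`). -/
def phiMasks : List ℕ :=
  [1695, 46290, 37110, 34590, 57720, 2415, 11595, 24825, 40710, 53940, 63120, 7815, 30945, 28425, 19245, 63840]

/-- The literal table `phiMasks` is the list of the masks of `t·Φ`, `t = unit j`, `j = 0, …, 15`. -/
theorem phiMasks_spec : phiMasks = (List.range 16).map (fun j => mulMask (unit j) phiMask) := by decide

/-- `S` balanced for `Φ`: `2·|S ∩ t·Φ| = |S|` for all 16 units `t` — equivalently `2·|t⁻¹S ∩ Φ| = |S|`, i.e. the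
balance of `S` at every translation (`t ↦ t⁻¹` permutes the units). -/
def balancedB (m : ℕ) : Bool := phiMasks.all (fun f => 2 * popcount (m &&& f) == popcount m)

/-- The least set bit of `m` among the 16 low bits (0 if none). -/
def leastBit (m : ℕ) : ℕ := (idxs.find? (fun i => (m >>> i) &&& 1 == 1)).getD 0

/-- `decomp fuel m`: `m` is a disjoint union of conjugate pairs `{i, 15 − i}` and cosets `{j : j ≡ i mod 4}` of `⟨9⟩`,
found greedily from the least element (both options tried). `fuel = 9` suffices for 16 points. -/
def decomp : ℕ → ℕ → Bool
  | 0, _ => false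
  | fuel + 1, m =>
    if m == 0 then true else
      let i := leastBit m
      let pair := 2 ^ i + 2 ^ (15 - i)
      let cos := 4369 <<< (i % 4)
      ((pair &&& m == pair) && decomp fuel (m ^^^ pair)) || ((cos &&& m == cos) && decomp fuel (m ^^^ cos))

/-- `scan lo n acc`: walks the masks `lo + n − 1, …, lo`; on a balanced mask that is NOT decomposable it returns `none`,
otherwise it counts the balanced masks into `acc` and returns `some (acc + #balanced)`. -/
def scan (lo : ℕ) : ℕ → ℕ → Option ℕ
  | 0, acc => some acc
  | n + 1, acc =>
    if balancedB (lo + n) then (if decomp 9 (lo + n) then scan lo n (acc + 1) else none) else scan lo n acc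

/-- `scan lo n acc = some c` means: every balanced mask among `lo, …, lo + n − 1` is decomposable. -/
theorem scan_spec (lo : ℕ) : ∀ n acc c, scan lo n acc = some c →
    ∀ j, j < n → balancedB (lo + j) = true → decomp 9 (lo + j) = true := by
  intro n
  induction n with
  | zero => intro _ _ _ j hj; exact absurd hj (Nat.not_lt_zero j)
  | succ n ih =>
    intro acc c h j hj hb
    simp only [scan] at h
    rcases Nat.lt_succ_iff_lt_or_eq.mp hj with hlt | heq
    · split at h
      · split at h
        · exact ih _ _ h j hlt hb
        · exact absurd h (by simp)
      · exact ih _ _ h j hlt hb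
    · subst heq
      split at h
      · split at h
        · assumption
        · exact absurd h (by simp)
      · simp_all

/-- Block 0: masks `0·4096 … 0·4096 + 4095`, every balanced one decomposable; the balanced count returned. -/ theorem block_0 : scan (0 * 4096) 4096 0 = some 16 := by decide +kernel
/-- Block 1: masks `1·4096 … 1·4096 + 4095`, every balanced one decomposable; the balanced count returned. -/ theorem block_1 : scan (1 * 4096) 4096 0 = some 20 := by decide +kernel
/-- Block 2: masks `2·4096 … 2·4096 + 4095`, every balanced one decomposable; the balanced count returned. -/ theorem block_2 : scan (2 * 4096) 4096 0 = some 20 := by decide +kernel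
/-- Block 3: masks `3·4096 … 3·4096 + 4095`, every balanced one decomposable; the balanced count returned. -/ theorem block_3 : scan (3 * 4096) 4096 0 = some 25 := by decide +kernel
/-- Block 4: masks `4·4096 … 4·4096 + 4095`, every balanced one decomposable; the balanced count returned. -/ theorem block_4 : scan (4 * 4096) 4096 0 = some 20 := by decide +kernel
/-- Block 5: masks `5·4096 … 5·4096 + 4095`, every balanced one decomposable; the balanced count returned. -/ theorem block_5 : scan (5 * 4096) 4096 0 = some 25 := by decide +kernel
/-- Block 6: masks `6·4096 … 6·4096 + 4095`, every balanced one decomposable; the balanced count returned. -/ theorem block_6 : scan (6 * 4096) 4096 0 = some 16 := by decide +kernel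
/-- Block 7: masks `7·4096 … 7·4096 + 4095`, every balanced one decomposable; the balanced count returned. -/ theorem block_7 : scan (7 * 4096) 4096 0 = some 20 := by decide +kernel
/-- Block 8: masks `8·4096 … 8·4096 + 4095`, every balanced one decomposable; the balanced count returned. -/ theorem block_8 : scan (8 * 4096) 4096 0 = some 20 := by decide +kernel
/-- Block 9: masks `9·4096 … 9·4096 + 4095`, every balanced one decomposable; the balanced count returned. -/ theorem block_9 : scan (9 * 4096) 4096 0 = some 16 := by decide +kernel
/-- Block 10: masks `10·4096 … 10·4096 + 4095`, every balanced one decomposable; the balanced count returned. -/ theorem block_10 : scan (10 * 4096) 4096 0 = some 25 := by decide +kernel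
/-- Block 11: masks `11·4096 … 11·4096 + 4095`, every balanced one decomposable; the balanced count returned. -/ theorem block_11 : scan (11 * 4096) 4096 0 = some 20 := by decide +kernel
/-- Block 12: masks `12·4096 … 12·4096 + 4095`, every balanced one decomposable; the balanced count returned. -/ theorem block_12 : scan (12 * 4096) 4096 0 = some 25 := by decide +kernel
/-- Block 13: masks `13·4096 … 13·4096 + 4095`, every balanced one decomposable; the balanced count returned. -/ theorem block_13 : scan (13 * 4096) 4096 0 = some 20 := by decide +kernel
/-- Block 14: masks `14·4096 … 14·4096 + 4095`, every balanced one decomposable; the balanced count returned. -/ theorem block_14 : scan (14 * 4096) 4096 0 = some 20 := by decide +kernel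
/-- Block 15: masks `15·4096 … 15·4096 + 4095`, every balanced one decomposable; the balanced count returned. -/ theorem block_15 : scan (15 * 4096) 4096 0 = some 16 := by decide +kernel

/-- The block counts of balanced masks sum to 324 = 1 + 8 + 32 + 72 + 98 + 72 + 32 + 8 + 1 (sizes 0, 2, …, 16). -/
theorem balanced_total : 16 + 20 + 20 + 25 + 20 + 25 + 16 + 20 + 20 + 16 + 25 + 20 + 25 + 20 + 20 + 16 = 324 := by
  norm_num

/-- THE CENSUS: every balanced subset of `(ℤ/32)^×` for `Φ(B₀)` is a disjoint union of conjugate pairs and cosets of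
`⟨9⟩ = {1, 9, 17, 25}` (all 65536 subsets). -/
theorem b0_census : ∀ m, m < 65536 → balancedB m = true → decomp 9 m = true := by
  intro m hm hb
  have hmod : m % 4096 < 4096 := Nat.mod_lt _ (by norm_num)
  have hrepr : m = m / 4096 * 4096 + m % 4096 := by omega
  have hdiv : m / 4096 < 16 := by omega
  rw [hrepr] at hb ⊢
  interval_cases h : m / 4096
  · exact scan_spec _ _ _ _ block_0 _ hmod hb
  · exact scan_spec _ _ _ _ block_1 _ hmod hb
  · exact scan_spec _ _ _ _ block_2 _ hmod hb
  · exact scan_spec _ _ _ _ block_3 _ hmod hb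
  · exact scan_spec _ _ _ _ block_4 _ hmod hb
  · exact scan_spec _ _ _ _ block_5 _ hmod hb
  · exact scan_spec _ _ _ _ block_6 _ hmod hb
  · exact scan_spec _ _ _ _ block_7 _ hmod hb
  · exact scan_spec _ _ _ _ block_8 _ hmod hb
  · exact scan_spec _ _ _ _ block_9 _ hmod hb
  · exact scan_spec _ _ _ _ block_10 _ hmod hb
  · exact scan_spec _ _ _ _ block_11 _ hmod hb
  · exact scan_spec _ _ _ _ block_12 _ hmod hb
  · exact scan_spec _ _ _ _ block_13 _ hmod hb
  · exact scan_spec _ _ _ _ block_14 _ hmod hb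
  · exact scan_spec _ _ _ _ block_15 _ hmod hb

/-- `Δ = {1,9,17,25}` itself is balanced for `Φ` (the `ℚ(ζ₈)`-Weil orbit of B₀ is a Hodge class), as are the
`ℚ(i)`-Weil 8-set `Δ ⊔ 5Δ` and the `ℚ(√−2)`-Weil 8-set `Δ ⊔ 3Δ`. -/
theorem delta_balanced :
    balancedB (4369 <<< 0) = true ∧ balancedB (4369 <<< 0 + 4369 <<< 2) = true ∧
    balancedB (4369 <<< 0 + 4369 <<< 1) = true := by decide +kernel

/-! ### (B) the `ℚ(ζ₈)`-Weil structure of A′ -/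

/-- The CM type `T′` of A′ inside `(ℤ/96)^×` (P1-HypergeometricJacobians Theorem C; l.8134 (1)(d)). -/
def Tp : List ℕ := [13, 19, 29, 31, 35, 41, 49, 53, 59, 71, 73, 79, 85, 89, 91, 95]

/-- The units of `ℤ/96`. -/
def U96 : List ℕ := (List.range 96).filter (fun k => k % 2 == 1 && k % 3 != 0)

/-- `(ℤ/96)^×` has 32 elements. -/
theorem U96_card : U96.length = 32 := by decide

/-- `T′` is a CM type of `ℚ(ζ₉₆)`: it contains exactly one of `k, −k` for every unit `k`. -/
theorem Tp_cm_type : U96.all (fun k => (Tp.contains k) != (Tp.contains ((96 - k) % 96))) = true := by decide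

/-- Each `ℚ(ζ₈)`-fibre `F_φ` has 8 elements and meets `T′` in exactly 4 — Weil type over `ℚ(ζ₈)`, `h = 8`, (4,4). -/
theorem Tp_fibres : [1, 3, 5, 7].all (fun φ =>
    ((U96.filter (fun k => k % 8 == φ)).length == 8) &&
    ((Tp.filter (fun k => k % 8 == φ)).length == 4)) = true := by decide

/-- `F_φ ⊔ F_φ′` (`φ ≠ φ′`) is closed under `k ↦ −k` iff `φ + φ′ ≡ 0 mod 8`. -/
theorem fibre_union_neg : [1, 3, 5, 7].all (fun φ => [1, 3, 5, 7].all (fun ψ => (φ == ψ) ||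
    ((U96.all (fun k => !(k % 8 == φ || k % 8 == ψ) || (((96 - k) % 96) % 8 == φ || ((96 - k) % 96) % 8 == ψ)))
      == ((φ + ψ) % 8 == 0)))) = true := by decide

/-! ### (C) the exponent tuple of C₃ -/

/-- Schoen's Lemma 1.6b multiplicity for a 4-point totally ramified ℤ/32-cover of ℙ¹ with unit exponents `α`:
`ν_n(α) = −1 + Σ_i ⟨n α_i⟩_{32} / 32` (the bracket = the representative in `[0, 31]`). -/
def nu (a b c d n : ℕ) : ℕ := (n * a % 32 + n * b % 32 + n * c % 32 + n * d % 32) / 32 - 1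

/-- The lift count `#{k ∈ T′ : k ≡ n mod 32}`. -/
def liftCount (n : ℕ) : ℕ := (Tp.filter (fun k => k % 32 == n)).length

/-- The lift counts of `T′` mod 32 at the 16 units: `(n : ν_n) = 1:0, 3:1, 5:0, 7:1, 9:2, 11:0, 13:1, 15:1, 17:1, 19:1,
21:2, 23:0, 25:1, 27:2, 29:1, 31:2`. -/
theorem lift_counts : (List.range 16).map (fun i => liftCount (unit i)) =
    [0, 1, 0, 1, 2, 0, 1, 1, 1, 1, 2, 0, 1, 2, 1, 2] := by decide

/-- The tuple `(7, 21, 1, 3)` has exactly the lift-count multiplicities of `T′` at every unit `n`. -/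
theorem tuple_multiplicities : (List.range 16).all (fun i => nu 7 21 1 3 (unit i) == liftCount (unit i)) = true := by
  decide

/-- Does a sorted quadruple of units `a ≤ b ≤ c ≤ d` with `a+b+c+d ≡ 0 mod 32` have the `T′` pattern? -/
def pattern (a b c d : ℕ) : Bool :=
  ((a + b + c + d) % 32 == 0) && (List.range 16).all (fun i => nu a b c d (unit i) == liftCount (unit i))

/-- The quadruples (as codes `i + 16 j + 256 k + 4096 l` with `i ≤ j ≤ k ≤ l`) having the pattern; all 65536 codes are
examined. -/
def patternCodes : ℕ → List ℕ → List ℕ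
  | 0, acc => acc
  | n + 1, acc =>
    let i := n % 16; let j := n / 16 % 16; let k := n / 256 % 16; let l := n / 4096
    patternCodes n (if i ≤ j && j ≤ k && k ≤ l && pattern (unit i) (unit j) (unit k) (unit l) then n :: acc else acc)

/-- UNIQUENESS: the only multiset of four units mod 32 with sum `≡ 0` and the multiplicity pattern of `T′` is
`{1, 3, 7, 21}` (indices 0, 1, 3, 10: code `0 + 16·1 + 256·3 + 4096·10 = 41744`). -/
theorem tuple_unique : patternCodes 65536 [] = [41744] := by decide +kernel

/-- The code `41744` decodes to the quadruple `(1, 3, 7, 21)`. -/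
theorem code_41744 : [unit (41744 % 16), unit (41744 / 16 % 16), unit (41744 / 256 % 16), unit (41744 / 4096)] =
    [1, 3, 7, 21] := by decide

/-! ### (D) simplicity is automatic from balance (m = 8 without 2, 6; m = 4) -/

/-- Schoen's balance condition (Corollary 1.9, row S88-4) for a tuple `l` mod `m`: `Σ_i ⟨n ᾱ_i⟩_m = (m/2)·|l|` for every
unit `n` — here for `m = 8`, `n ∈ {1, 3, 5, 7}`. -/
def balanced8 (l : List ℕ) : Prop := ∀ n ∈ [1, 3, 5, 7], (l.map (fun a => n * a % 8)).sum = 4 * l.length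

/-- Schoen's SIMPLE (p. 11) in count form: the tuple pairs off as `{a, −a}`: `count a = count (−a)` for `a ≠ −a` and
`count 4` even. -/
def simple8 (l : List ℕ) : Prop :=
  l.count 1 = l.count 7 ∧ l.count 3 = l.count 5 ∧ l.count 2 = l.count 6 ∧ Even (l.count 4)

/-- Balance for `m = 4`: `n ∈ {1, 3}`. -/
def balanced4 (l : List ℕ) : Prop := ∀ n ∈ [1, 3], (l.map (fun a => n * a % 4)).sum = 2 * l.length

/-- Simple for `m = 4`: `count 1 = count 3` and `count 2` even. -/
def simple4 (l : List ℕ) : Prop := l.count 1 = l.count 3 ∧ Even (l.count 2)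

/-- A sum over a list with entries in `{1, 3, 4, 5, 7}` is the count-weighted sum of the five values. -/
theorem sum_map_by_counts8 (f : ℕ → ℕ) (l : List ℕ) (h : ∀ a ∈ l, a ∈ [1, 3, 4, 5, 7]) :
    (l.map f).sum = l.count 1 * f 1 + l.count 3 * f 3 + l.count 4 * f 4 + l.count 5 * f 5 + l.count 7 * f 7 := by
  induction l with
  | nil => simp
  | cons a l ih =>
    have ha : a ∈ [1, 3, 4, 5, 7] := h a (List.mem_cons_self ..)
    have ih' := ih (fun b hb => h b (List.mem_cons_of_mem a hb))
    simp only [List.map_cons, List.sum_cons, List.count_cons, beq_iff_eq, ih']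
    simp only [List.mem_cons, List.not_mem_nil, or_false] at ha
    rcases ha with rfl | rfl | rfl | rfl | rfl <;> simp <;> ring

/-- A sum over a list with entries in `{1, 2, 3}` is the count-weighted sum of the three values. -/
theorem sum_map_by_counts4 (f : ℕ → ℕ) (l : List ℕ) (h : ∀ a ∈ l, a ∈ [1, 2, 3]) :
    (l.map f).sum = l.count 1 * f 1 + l.count 2 * f 2 + l.count 3 * f 3 := by
  induction l with
  | nil => simp
  | cons a l ih =>
    have ha : a ∈ [1, 2, 3] := h a (List.mem_cons_self ..)
    have ih' := ih (fun b hb => h b (List.mem_cons_of_mem a hb))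
    simp only [List.map_cons, List.sum_cons, List.count_cons, beq_iff_eq, ih']
    simp only [List.mem_cons, List.not_mem_nil, or_false] at ha
    rcases ha with rfl | rfl | rfl <;> simp <;> ring

/-- The length of a list with entries in `{1, 3, 4, 5, 7}` is the sum of the five counts. -/
theorem length_by_counts8 (l : List ℕ) (h : ∀ a ∈ l, a ∈ [1, 3, 4, 5, 7]) :
    l.length = l.count 1 + l.count 3 + l.count 4 + l.count 5 + l.count 7 := by
  have := sum_map_by_counts8 (fun _ => 1) l h
  simpa using this

/-- The length of a list with entries in `{1, 2, 3}` is the sum of the three counts. -/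
theorem length_by_counts4 (l : List ℕ) (h : ∀ a ∈ l, a ∈ [1, 2, 3]) :
    l.length = l.count 1 + l.count 2 + l.count 3 := by
  have := sum_map_by_counts4 (fun _ => 1) l h
  simpa using this

/-- THE ROBUSTNESS LEMMA, `m = 8`: a tuple with entries in `{1, 3, 4, 5, 7}` of even length that is balanced is simple. -/
theorem simple8_of_balanced8 (l : List ℕ) (h : ∀ a ∈ l, a ∈ [1, 3, 4, 5, 7]) (hev : Even l.length)
    (hb : balanced8 l) : simple8 l := by
  have h1 := hb 1 (by simp); have h3 := hb 3 (by simp); have h5 := hb 5 (by simp); have h7 := hb 7 (by simp)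
  have e1 : (l.map (fun a => 1 * a % 8)).sum =
      l.count 1 * 1 + l.count 3 * 3 + l.count 4 * 4 + l.count 5 * 5 + l.count 7 * 7 :=
    sum_map_by_counts8 (fun a => 1 * a % 8) l h
  have e3 : (l.map (fun a => 3 * a % 8)).sum =
      l.count 1 * 3 + l.count 3 * 1 + l.count 4 * 4 + l.count 5 * 7 + l.count 7 * 5 :=
    sum_map_by_counts8 (fun a => 3 * a % 8) l h
  have e5 : (l.map (fun a => 5 * a % 8)).sum =
      l.count 1 * 5 + l.count 3 * 7 + l.count 4 * 4 + l.count 5 * 1 + l.count 7 * 3 :=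
    sum_map_by_counts8 (fun a => 5 * a % 8) l h
  have e7 : (l.map (fun a => 7 * a % 8)).sum =
      l.count 1 * 7 + l.count 3 * 5 + l.count 4 * 4 + l.count 5 * 3 + l.count 7 * 1 :=
    sum_map_by_counts8 (fun a => 7 * a % 8) l h
  rw [e1] at h1; rw [e3] at h3; rw [e5] at h5; rw [e7] at h7
  have hlen := length_by_counts8 l h
  have h2 : l.count 2 = 0 := List.count_eq_zero.mpr (fun hm => by simpa using h 2 hm)
  have h6 : l.count 6 = 0 := List.count_eq_zero.mpr (fun hm => by simpa using h 6 hm)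
  refine ⟨?_, ?_, by rw [h2, h6], ?_⟩
  · omega
  · omega
  · rcases hev with ⟨k, hk⟩
    exact ⟨k - l.count 1 - l.count 3, by omega⟩

/-- THE ROBUSTNESS LEMMA, `m = 4` (Aoki's theorem for `m = 4`): every balanced tuple of even length is simple. -/
theorem simple4_of_balanced4 (l : List ℕ) (h : ∀ a ∈ l, a ∈ [1, 2, 3]) (hev : Even l.length)
    (hb : balanced4 l) : simple4 l := by
  have h1 := hb 1 (by simp); have h3 := hb 3 (by simp)
  have e1 : (l.map (fun a => 1 * a % 4)).sum = l.count 1 * 1 + l.count 2 * 2 + l.count 3 * 3 :=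
    sum_map_by_counts4 (fun a => 1 * a % 4) l h
  have e3 : (l.map (fun a => 3 * a % 4)).sum = l.count 1 * 3 + l.count 2 * 2 + l.count 3 * 1 :=
    sum_map_by_counts4 (fun a => 3 * a % 4) l h
  rw [e1] at h1; rw [e3] at h3
  have hlen := length_by_counts4 l h
  refine ⟨by omega, ?_⟩
  rcases hev with ⟨k, hk⟩
  exact ⟨k - l.count 1, by omega⟩

/-- The tuple of `(C′, μ₈)` (Theorem D (ii)): `(3,3,4,4,4,4,5,5)` is balanced, hence simple. -/
theorem Cprime_simple : balanced8 [3, 3, 4, 4, 4, 4, 5, 5] ∧ simple8 [3, 3, 4, 4, 4, 4, 5, 5] := by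
  refine ⟨by unfold balanced8; decide, simple8_of_balanced8 _ (by decide) (by decide) (by unfold balanced8; decide)⟩

/-- The tuple of `(C₃, μ₈)` (Theorem E): `(7, 21, 1, 3) mod 8 = (7, 5, 1, 3)` is balanced, hence simple. -/
theorem C3_simple : balanced8 [7, 5, 1, 3] ∧ simple8 [7, 5, 1, 3] := by
  refine ⟨by unfold balanced8; decide, simple8_of_balanced8 _ (by decide) (by decide) (by unfold balanced8; decide)⟩

/-- `(7, 21, 1, 3) mod 8 = (7, 5, 1, 3)`, and the tuple sums to `32 ≡ 0`. -/
theorem C3_tuple_mod8 : [7 % 8, 21 % 8, 1 % 8, 3 % 8] = [7, 5, 1, 3] ∧ (7 + 21 + 1 + 3) % 32 = 0 := by decide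

/-- `tuple_simple_mod8` of the header: the tuple of `C₃` is simple and balanced mod 8. -/
theorem tuple_simple_mod8 : simple8 [7, 5, 1, 3] := C3_simple.2

end HodgeRepro0.P8HCofB0FiniteFacts
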